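import Literature.NumberTheory.Automorphic.UnitaryThreeDoubleCosetsHK            -- ★ (F1) B-p17 (g24): `U = ⊔_m H u_m K₀` [Flicker1998UnitaryFL, Prop. 4]
import Literature.NumberTheory.Automorphic.FixedPointsDoubleCosetUnfolding       -- ★ (F2a): the abstract unfolding of fixed points
import HarnessLib

/-!
# Flicker's Proposition 5 for `U(2,1)`: the `t`-fixed points of `U ⧸ K₀` unfold over the double cosets `H u_m K₀`
(Flicker (1998), *Elementary proof of the fundamental lemma for a unitary group*, Prop. 5 p. 82)

Topic `NumberTheory/Automorphic`; namespace `Literature.NumberTheory.Automorphic.UnitaryGroup`.  KERNEL mathematics only: theorems, no definition, no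
named fact, no instance, no notation, no `sorry`.  Cell `pub/hodgecm-mathlib`, programme P3a, road «D-N7-inert», MAP v3 «N7-ns COUNT FROM FLICKER» brick
(F2) = (F2a) ★ `FixedPointsDoubleCosetUnfolding` (pure group theory) DRESSED here in the frame of ★ (F1) `UnitaryThreeDoubleCosetsHK` (B-p17 (g24)):
`U = U(σ, Φ₃)(K)` for a valued field `K` with `LocalConjDatum σ ϖ`, `K₀ = unitaryInt σ Φ₃ = U ∩ GL₃(𝒪)`, `H = Z_U(c)`, `c = diag(1,−1,1)`
(`≅ U(1,1) × U(1)`), `u_m` Flicker's representatives (`!![ϖ^m, y, ϖ^{-m}; 0, 1, −σy ϖ^{-m}; 0, 0, ϖ^{-m}]`, `y σy = −2`), `H^K_m = H ∩ u_m K₀ u_m⁻¹`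
(read as congruences by ★ `flickerU_inv_mul_mul_flickerU_mem_unitaryInt_iff`).  LEAD F0P3a-plan (g9) T8-41 deal (F2); architect A-p06 (g26).
HC_CM is proved only modulo the printed citations (2 remaining named inputs hLiu418, h413) until rung 0 closes; this file discharges no named fact.

STATEMENT.  For `t ∈ H` with finitely many fixed points on `U ⧸ K₀` (in the tree's currency ★ `orbitalIntegral_indicator_quotientMeasure_eq_natCard_fixedPoints`:
`Φ(t, 1_{K₀}) = #{q ∈ U ⧸ K₀ : t • q = q}` at `vol K₀ = 1`, torus mass one — Flicker's «`∫_{G∕K} 1_K(x⁻¹tx) dx`», p. 82):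
**`#{q ∈ U ⧸ K₀ : t • q = q} = Σᶠ_{m ≥ 0} #{h H^K_m ∈ H ⧸ H^K_m : t • hH^K_m = hH^K_m}`** and `t • hH^K_m = hH^K_m ↔ (h u_m)⁻¹ t (h u_m) ∈ K₀`
(«`= Σ_m ∫_{H∕H^K_m} 1_{H^K_m}(h⁻¹th) dh`»), from (F1)'s existence `exists_mem_centralizer_mul_flickerU_mul_mem_unitaryInt` and distinctness
`eq_of_centralizer_mul_flickerU_mul_unitaryInt_eq` through (F2a) `natCard_fixedPoints_eq_finsum`; also the bijection itself (`exists_equiv_fixedPoints_sigma_flickerU`).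
The representatives `u : ℕ → U` are a BINDER with their matrices (`hu`); ★ `exists_coe_eq_flickerU` supplies them.  NOT here: the identification of the summands
with Flicker's congruence counts (Props. 10–14 = (F4)–(F8), A-p03 (g24)) and the passage `Φ(t,1_{K′}) ↦ #Fix` ((F0) ★ `UnitFundamentalLemmaInertFlickerFrame` + ★ (L2)).

References: [Flicker1998UnitaryFL] Y. Z. Flicker, Canad. J. Math. 50 (1998), Prop. 4 pp. 80–81, Prop. 5 p. 82 · [Rogawski1990] J. D. Rogawski, Ann. of Math. Stud. 123, §4.9 p. 54. -/

set_option autoImplicit false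

open scoped MatrixGroups WithZero

namespace Literature.NumberTheory.Automorphic

namespace UnitaryGroup

open Literature.NumberTheory.Automorphic.HermitianLattice (unitaryInt LocalConjDatum)
open Literature.NumberTheory.Automorphic.DoubleCosetFixedPoints

variable {K : Type*} [Field K] [Valued K ℤᵐ⁰] {ϖ : K}
  (σ : K →+* K) {J : Matrix (Fin 3) (Fin 3) K} (hJ : J = (StdForm.antidiagonal 3).over K)

include hJ in
/-- (F1) in the abstract shape `hA`∕`hB` of ★ (F2a): with Flicker's representatives `u_m` (given with their matrices), every `g ∈ U` is `h u_m k`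
(`h ∈ H = Z_U(c)`, `k ∈ K₀`) and the index `m` of the double coset `H g K₀` is unique. [cite: Flicker1998UnitaryFL, Prop. 4 pp. 80–81] -/
theorem flickerU_doubleCoset_cover_and_disjoint (hd : LocalConjDatum σ ϖ) {y : K} (hy : y * σ y = -2)
    {c : ↥(unitaryGroupOfForm σ J)} (hc : ((c : GL (Fin 3) K) : Matrix (Fin 3) (Fin 3) K) = !![1, 0, 0; 0, -1, 0; 0, 0, 1])
    (u : ℕ → ↥(unitaryGroupOfForm σ J))
    (hu : ∀ m, ((u m : GL (Fin 3) K) : Matrix (Fin 3) (Fin 3) K) = !![ϖ ^ m, y, (ϖ ^ m)⁻¹; 0, 1, -σ y * (ϖ ^ m)⁻¹; 0, 0, (ϖ ^ m)⁻¹]) :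
    (∀ g : ↥(unitaryGroupOfForm σ J), ∃ m, ∃ h ∈ Subgroup.centralizer ({c} : Set ↥(unitaryGroupOfForm σ J)), ∃ k ∈ unitaryInt σ J,
        g = h * u m * k) ∧
      ∀ m n, ∀ h ∈ Subgroup.centralizer ({c} : Set ↥(unitaryGroupOfForm σ J)), ∀ h' ∈ Subgroup.centralizer ({c} : Set ↥(unitaryGroupOfForm σ J)),
        ∀ k ∈ unitaryInt σ J, ∀ k' ∈ unitaryInt σ J, h * u m * k = h' * u n * k' → m = n := by
  refine ⟨fun g => ?_, fun m n h hh h' hh' k hk k' hk' heq => ?_⟩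
  · obtain ⟨m, h, u', k, hh, hu', hk, hg⟩ := exists_mem_centralizer_mul_flickerU_mul_mem_unitaryInt σ hJ hd hy hc g
    have huu : u' = u m := Subtype.ext (Matrix.GeneralLinearGroup.ext fun i j => by rw [hu', hu m])
    exact ⟨m, h, hh, k, hk, by rw [hg, huu]⟩
  · exact eq_of_centralizer_mul_flickerU_mul_unitaryInt_eq σ hJ hd hy hc hh (hu m) hk hh' (hu n) hk' heq

set_option synthInstance.maxHeartbeats 200000 in
-- the `H`-action on `H ⧸ H^K_m` is found through the large subgroup terms of the `U(2,1)` frame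
include hJ in
/-- **FLICKER'S PROPOSITION 5 (bijection form) for `U(2,1)`**: for `t ∈ H = Z_U(diag(1,−1,1))`, the `t`-fixed points of `U ⧸ K₀` are in bijection with
`Σ_m {hH^K_m ∈ H ⧸ H^K_m : t • hH^K_m = hH^K_m}`, `H^K_m = H ∩ u_m K₀ u_m⁻¹` (`(m, hH^K_m) ↦ h u_m K₀`). [cite: Flicker1998UnitaryFL, Prop. 5 p. 82] -/
theorem exists_equiv_fixedPoints_sigma_flickerU (hd : LocalConjDatum σ ϖ) {y : K} (hy : y * σ y = -2)
    {c : ↥(unitaryGroupOfForm σ J)} (hc : ((c : GL (Fin 3) K) : Matrix (Fin 3) (Fin 3) K) = !![1, 0, 0; 0, -1, 0; 0, 0, 1])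
    (u : ℕ → ↥(unitaryGroupOfForm σ J))
    (hu : ∀ m, ((u m : GL (Fin 3) K) : Matrix (Fin 3) (Fin 3) K) = !![ϖ ^ m, y, (ϖ ^ m)⁻¹; 0, 1, -σ y * (ϖ ^ m)⁻¹; 0, 0, (ϖ ^ m)⁻¹])
    {t : ↥(unitaryGroupOfForm σ J)} (ht : t ∈ Subgroup.centralizer ({c} : Set ↥(unitaryGroupOfForm σ J))) :
    Nonempty ({q : ↥(unitaryGroupOfForm σ J) ⧸ unitaryInt σ J // t • q = q} ≃
      Σ m : ℕ, {z : ↥(Subgroup.centralizer ({c} : Set ↥(unitaryGroupOfForm σ J))) ⧸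
          ((unitaryInt σ J).map (MulAut.conj (u m)).toMonoidHom).subgroupOf (Subgroup.centralizer ({c} : Set ↥(unitaryGroupOfForm σ J))) //
        (⟨t, ht⟩ : ↥(Subgroup.centralizer ({c} : Set ↥(unitaryGroupOfForm σ J)))) • z = z}) := by
  obtain ⟨hA, hB⟩ := flickerU_doubleCoset_cover_and_disjoint σ hJ hd hy hc u hu
  exact exists_equiv_fixedPoints_sigma _ _ u hA hB ht

set_option synthInstance.maxHeartbeats 200000 in
-- the `H`-action on `H ⧸ H^K_m` is found through the large subgroup terms of the `U(2,1)` frame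
include hJ in
/-- **FLICKER'S PROPOSITION 5 (counted) for `U(2,1)`**: for `t ∈ H` with finitely many fixed points on `U ⧸ K₀` (e.g. `t` regular),
**`#{q ∈ U ⧸ K₀ : t • q = q} = Σᶠ_{m ≥ 0} #{hH^K_m : t • hH^K_m = hH^K_m}`** — «`∫_{G∕K} 1_K(x⁻¹tx) dx = Σ_{m ≥ 0} ∫_{H∕H^K_m} 1_{H^K_m}(h⁻¹th) dh`» with
counting measures (`vol K = 1`, torus mass one: ★ `orbitalIntegral_indicator_quotientMeasure_eq_natCard_fixedPoints`); the summand's condition reads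
`(h u_m)⁻¹ t (h u_m) ∈ K₀` (★ `DoubleCosetFixedPoints.smul_mk_eq_iff`), i.e. Flicker's congruences (★ `flickerU_inv_mul_mul_flickerU_mem_unitaryInt_iff`).
[cite: Flicker1998UnitaryFL, Prop. 5 p. 82] -/
theorem natCard_fixedPoints_unitaryInt_eq_finsum_flickerU (hd : LocalConjDatum σ ϖ) {y : K} (hy : y * σ y = -2)
    {c : ↥(unitaryGroupOfForm σ J)} (hc : ((c : GL (Fin 3) K) : Matrix (Fin 3) (Fin 3) K) = !![1, 0, 0; 0, -1, 0; 0, 0, 1])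
    (u : ℕ → ↥(unitaryGroupOfForm σ J))
    (hu : ∀ m, ((u m : GL (Fin 3) K) : Matrix (Fin 3) (Fin 3) K) = !![ϖ ^ m, y, (ϖ ^ m)⁻¹; 0, 1, -σ y * (ϖ ^ m)⁻¹; 0, 0, (ϖ ^ m)⁻¹])
    {t : ↥(unitaryGroupOfForm σ J)} (ht : t ∈ Subgroup.centralizer ({c} : Set ↥(unitaryGroupOfForm σ J)))
    (hfin : {q : ↥(unitaryGroupOfForm σ J) ⧸ unitaryInt σ J | t • q = q}.Finite) :
    Nat.card {q : ↥(unitaryGroupOfForm σ J) ⧸ unitaryInt σ J | t • q = q} =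
      ∑ᶠ m : ℕ, Nat.card {z : ↥(Subgroup.centralizer ({c} : Set ↥(unitaryGroupOfForm σ J))) ⧸
          ((unitaryInt σ J).map (MulAut.conj (u m)).toMonoidHom).subgroupOf (Subgroup.centralizer ({c} : Set ↥(unitaryGroupOfForm σ J))) |
        (⟨t, ht⟩ : ↥(Subgroup.centralizer ({c} : Set ↥(unitaryGroupOfForm σ J)))) • z = z} := by
  obtain ⟨hA, hB⟩ := flickerU_doubleCoset_cover_and_disjoint σ hJ hd hy hc u hu
  exact natCard_fixedPoints_eq_finsum _ _ u hA hB ht hfin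

set_option synthInstance.maxHeartbeats 200000 in
-- the `H`-action on `H ⧸ H^K_m` is found through the large subgroup terms of the `U(2,1)` frame
include hJ in
/-- Only finitely many double cosets `H u_m K₀` carry a `t`-fixed point, and each carries finitely many (so the `Σᶠ` above is an honest finite sum
«over `0 ≤ m ≤ M(t)`»). [cite: Flicker1998UnitaryFL, Prop. 5 p. 82] -/
theorem finite_setOf_nonempty_fixedPoints_flickerU (hd : LocalConjDatum σ ϖ) {y : K} (hy : y * σ y = -2)
    {c : ↥(unitaryGroupOfForm σ J)} (hc : ((c : GL (Fin 3) K) : Matrix (Fin 3) (Fin 3) K) = !![1, 0, 0; 0, -1, 0; 0, 0, 1])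
    (u : ℕ → ↥(unitaryGroupOfForm σ J))
    (hu : ∀ m, ((u m : GL (Fin 3) K) : Matrix (Fin 3) (Fin 3) K) = !![ϖ ^ m, y, (ϖ ^ m)⁻¹; 0, 1, -σ y * (ϖ ^ m)⁻¹; 0, 0, (ϖ ^ m)⁻¹])
    {t : ↥(unitaryGroupOfForm σ J)} (ht : t ∈ Subgroup.centralizer ({c} : Set ↥(unitaryGroupOfForm σ J)))
    (hfin : {q : ↥(unitaryGroupOfForm σ J) ⧸ unitaryInt σ J | t • q = q}.Finite) :
    {m : ℕ | Nonempty {z : ↥(Subgroup.centralizer ({c} : Set ↥(unitaryGroupOfForm σ J))) ⧸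
          ((unitaryInt σ J).map (MulAut.conj (u m)).toMonoidHom).subgroupOf (Subgroup.centralizer ({c} : Set ↥(unitaryGroupOfForm σ J))) //
        (⟨t, ht⟩ : ↥(Subgroup.centralizer ({c} : Set ↥(unitaryGroupOfForm σ J)))) • z = z}}.Finite ∧
      ∀ m : ℕ, Finite {z : ↥(Subgroup.centralizer ({c} : Set ↥(unitaryGroupOfForm σ J))) ⧸
          ((unitaryInt σ J).map (MulAut.conj (u m)).toMonoidHom).subgroupOf (Subgroup.centralizer ({c} : Set ↥(unitaryGroupOfForm σ J))) //
        (⟨t, ht⟩ : ↥(Subgroup.centralizer ({c} : Set ↥(unitaryGroupOfForm σ J)))) • z = z} := by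
  obtain ⟨hA, hB⟩ := flickerU_doubleCoset_cover_and_disjoint σ hJ hd hy hc u hu
  exact finite_setOf_nonempty_fixedPoints _ _ u hA hB ht hfin

set_option synthInstance.maxHeartbeats 200000 in
-- the `H`-action on `H ⧸ H^K_m` is found through the large subgroup terms of the `U(2,1)` frame
/-- The summand's condition in `U`: `t • (h H^K_m) = h H^K_m ↔ (h u_m)⁻¹ t (h u_m) ∈ K₀` — Flicker's `1_K(u_m⁻¹ h⁻¹ t h u_m) = 1_{H^K_m}(h⁻¹ t h)`.
[cite: Flicker1998UnitaryFL, Prop. 5 p. 82] -/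
theorem smul_mk_eq_iff_flickerU {c : ↥(unitaryGroupOfForm σ J)} (u : ℕ → ↥(unitaryGroupOfForm σ J)) (m : ℕ)
    (t h : ↥(Subgroup.centralizer ({c} : Set ↥(unitaryGroupOfForm σ J)))) :
    t • (QuotientGroup.mk h : ↥(Subgroup.centralizer ({c} : Set ↥(unitaryGroupOfForm σ J))) ⧸
        ((unitaryInt σ J).map (MulAut.conj (u m)).toMonoidHom).subgroupOf (Subgroup.centralizer ({c} : Set ↥(unitaryGroupOfForm σ J)))) =
      QuotientGroup.mk h ↔ ((h : ↥(unitaryGroupOfForm σ J)) * u m)⁻¹ * (t : ↥(unitaryGroupOfForm σ J)) * ((h : ↥(unitaryGroupOfForm σ J)) * u m) ∈ unitaryInt σ J :=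
  smul_mk_eq_iff _ _ u m t h

end UnitaryGroup

end Literature.NumberTheory.Automorphic
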